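import Summits.NavierStokesRegularity.NavierStokesRegularity.Theorems.SymmetryModuliCountSymmetricLiouville
import Summits.NavierStokesRegularity.NavierStokesRegularity.Theorems.SymmetryModuliCountAxisymEndLiouville
import Summits.NavierStokesRegularity.NavierStokesRegularity.Theorems.SymmetryModuliCountSymmetricLiouvilleAncientOseenBound
import Summits.NavierStokesRegularity.NavierStokesRegularity.Theorems.SymmetryModuliCountSymmetricLiouvilleKernelTimeWeightIntegral
import Summits.NavierStokesRegularity.NavierStokesRegularity.Theorems.SymmetryModuliCountSymmetricLiouvilleSlabKernelBound
import Summits.NavierStokesRegularity.NavierStokesRegularity.Theorems.SymmetryModuliCountSymmetricLiouvilleCrossingTimeIntegral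
import Summits.NavierStokesRegularity.NavierStokesRegularity.Theorems.SymmetryModuliCountSymmetricLiouvilleEnvelopeDecay
import Summits.NavierStokesRegularity.NavierStokesRegularity.Theorems.SymmetryModuliCountSymmetricLiouvilleOseenBootstrapOf
import Summits.NavierStokesRegularity.NavierStokesRegularity.Theorems.SymmetryModuliCountSymmetricLiouvilleRssCoreOfConjecture
import Summits.NavierStokesRegularity.NavierStokesRegularity.Theorems.TypeIDSSLiouvilleConjecture
import HarnessLib

/-!
# Route `SymmetryModuliCount`, crux `SymmetricLiouville` (stmt-NavierStokesRegularity-4053), line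
# `blowdown-kills-pitch` (lead c1): the Oseen bootstrap, the open core, and the crux modulo the canonical
# conjecture `TypeIDSSLiouvilleConjecture`

Summits-side theorem file (kind = proof, no definitions) assembling the second wave of landed stubs of the line:

* `oseenBootstrap` — **B2, the symmetry-free Oseen bootstrap** (the statement `stub_oseenBootstrap` of the crux
  cards `farfield-recentring-critical-rate` / `degenerate-stabiliser-zoom`): a Type-I ancient mild solution
  `u ∈ A_C` (`IsTypeIAncientMild C u`) whose scale-invariant size `√(−t)‖u(t,x)‖` is small outside paraboloids
  `‖x‖ ≥ R√(−t)` obeys the space–time Type-I bound `‖u(t,x)‖ ≤ K/(‖x‖ + √(−t))` (`HasTypeIDecay`, Pineau–Vicol's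
  class (1.10)) — from the landed stubs T1 `stub_ancientOseenBound`, T2 `stub_kernelTimeWeightIntegral`,
  T3 `stub_slabKernelBound`, T4 `stub_crossingTimeIntegral`, T5 `stub_envelopeDecay`, T6 `stub_oseenBootstrap_of`;
* `rssFarFieldTypeIDecay` — hence every (rotated) self-similar element of `A_C` lies in Pineau–Vicol's class
  (far-field vanishing `rssFarFieldVanishing` is already in the tree);
* `symmetricLiouville_iff_core` — **the crux is EQUIVALENT to its open core** (RSS elements of `A_C`, `A ≠ 0`, small
  far from the centre, vanish), unconditionally, since the route item `AxisymEndLiouville` (stmt-14061) is the tree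
  theorem `AxisymEndLiouville_of`;
* `core_iff_coreTypeI` — by B2 the open core is equivalent to RSS Liouville in Pineau–Vicol's class inside `A_C`
  (= Pineau–Vicol Conj. 1.1 / Tsai GSM 192 Conj. 8.9 in the gauge: the window `α ≈ 1` is open; the extremes are the
  tree theorem `pineauVicol2026_rss_liouville_holds` with solution-dependent thresholds);
* `symmetricLiouville_of_typeIDSSLiouvilleConjecture` — **the crux BY NAME from the canonical conjecture leaf**
  `Summit.NavierStokesRegularity.NavierStokesRegularity.TypeIDSSLiouvilleConjecture` (Bradshaw–Tsai OP 5.1, rotated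
  half), via the landed bridge T7 `stub_rssCoreOfConjecture`. CONDITIONAL result: the item stays open on the
  conjecture, which is the honest terminal state of this conjecture-grade crux.

References: Koch–Nadirashvili–Seregin–Šverák, Acta Math. 203 (2009) = arXiv:0709.3599, §4; Pineau–Vicol
arXiv:2607.09619, Conj. 1.1, (1.9)–(1.10), Thm 1.4; Bradshaw–Tsai, Comm. PDE 42 (2017), §5 OP 5.1; Tsai, GSM 192
(2018), Conj. 8.8–8.9.
-/

noncomputable section

set_option linter.dupNamespace false

open Set Function Filter MeasureTheory
open scoped Topology ENNReal
open Literature.Analysis.FluidPDE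
open Summit.NavierStokesRegularity.NavierStokesRegularity.Theses.SymmetryModuliCount

namespace Summit.NavierStokesRegularity.NavierStokesRegularity.Theorems.SymmetryModuliCountSymmetricLiouville

/-- Local notation for physical space `ℝ³`. -/
local notation "E3" => EuclideanSpace ℝ (Fin 3)

/-! ## B2 — the Oseen bootstrap -/

/-- **B2, the symmetry-free Oseen bootstrap.** A Type-I ancient mild solution `u ∈ A_C` whose scale-invariant size
`√(−t)‖u(t,x)‖` is at most `ε` whenever `‖x‖ ≥ R(ε)√(−t)`, for every `ε > 0`, obeys `‖u(t,x)‖ ≤ K/(‖x‖ + √(−t))`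
for some `K` (Pineau–Vicol's class (1.10)). Assembly of the landed stubs T1–T6 of line `blowdown-kills-pitch`.
[cite: KochNadirashviliSereginSverak2009, §4 (4.3)–(4.4) (arXiv:0709.3599 p. 8)] -/
theorem oseenBootstrap (C : ℝ) (u : ℝ → E3 → E3) (hu : IsTypeIAncientMild C u)
    (hfar : ∀ ε > 0, ∃ R : ℝ, ∀ t < 0, ∀ x, R * Real.sqrt (-t) ≤ ‖x‖ → Real.sqrt (-t) * ‖u t x‖ ≤ ε) :
    ∃ K : ℝ, HasTypeIDecay K u :=
  stub_oseenBootstrap_of stub_ancientOseenBound stub_kernelTimeWeightIntegral stub_slabKernelBound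
    stub_crossingTimeIntegral stub_envelopeDecay C u hu hfar

/-- **(Rotated) self-similar elements of `A_C` lie in Pineau–Vicol's class**: if `u ∈ A_C` is annihilated by the
spiral-scaling generator `∇u·(x + Ax) + u + 2t∂ₜu − Au` with `A` skew (any rate, `A = 0` allowed), then
`‖u(t,x)‖ ≤ K/(‖x‖ + √(−t))` for some `K` — far-field vanishing (`rssFarFieldVanishing`, tree) fed into B2.
[cite: PineauVicol2026, (1.9)–(1.10) (arXiv:2607.09619 p. 3)] -/
theorem rssFarFieldTypeIDecay (C : ℝ) (u : ℝ → E3 → E3) (hu : IsTypeIAncientMild C u)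
    (A : E3 →L[ℝ] E3) (hA : ∀ x, inner ℝ (A x) x = 0)
    (hL : ∀ t < 0, ∀ x, fderiv ℝ (u t) x (x + A x) + u t x + (2 * t) • timeDeriv u t x - A (u t x) = 0) :
    ∃ K : ℝ, HasTypeIDecay K u :=
  oseenBootstrap C u hu (rssFarFieldVanishing C u hu A hA hL)

/-! ## The crux and its open core -/

/-- **The crux `SymmetricLiouville` is EQUIVALENT to its open core** — rotated-self-similar elements of `A_C`
(`A ≠ 0` skew) whose scale-invariant size is small far from the centre vanish: `→` is the specialisation `a = 0`,
`σ = 1` (the far-field hypothesis is discarded); `←` is the tree assembly `symmetricLiouville_of_core` with the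
route item `AxisymEndLiouville` (stmt-14061) now the tree theorem `AxisymEndLiouville_of`. [cite: PineauVicol2026, Conjecture 1.1 (arXiv:2607.09619 p. 3)] -/
theorem symmetricLiouville_iff_core :
    SymmetricLiouville ↔
      ∀ (C : ℝ) (u : ℝ → E3 → E3), IsTypeIAncientMild C u →
        ∀ A : E3 →L[ℝ] E3, (∀ x, inner ℝ (A x) x = 0) → A ≠ 0 →
          (∀ t < 0, ∀ x, fderiv ℝ (u t) x (x + A x) + u t x + (2 * t) • timeDeriv u t x - A (u t x) = 0) →
          (∀ ε > 0, ∃ R : ℝ, ∀ t < 0, ∀ x, R * Real.sqrt (-t) ≤ ‖x‖ → Real.sqrt (-t) * ‖u t x‖ ≤ ε) →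
          ∀ t < 0, ∀ x, u t x = 0 := by
  constructor
  · intro h C u hcl A hA _ hL _
    refine h C u (isTypeIAncientMild_iff.1 hcl) 0 1 A hA (fun hz => one_ne_zero hz.2.1) ?_
    intro t ht x
    simpa only [zero_add, one_smul, mul_one] using hL t ht x
  · intro h
    exact symmetricLiouville_of_core h AxisymEndLiouville_of

/-- **By B2 the open core is equivalent to RSS Liouville in Pineau–Vicol's class inside `A_C`** (the far-field
hypothesis and the space–time Type-I bound are interchangeable for RSS elements of `A_C`: `→` by
`rssFarFieldVanishing`, `←` by `rssFarFieldTypeIDecay`). The right-hand side is Pineau–Vicol Conj. 1.1 / Tsai GSM 192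
Conj. 8.9 in the gauge class; its window `α ≈ 1` is open. [cite: PineauVicol2026, Conjecture 1.1 and Theorem 1.4 (arXiv:2607.09619 pp. 3–4)] -/
theorem core_iff_coreTypeI :
    (∀ (C : ℝ) (u : ℝ → E3 → E3), IsTypeIAncientMild C u →
        ∀ A : E3 →L[ℝ] E3, (∀ x, inner ℝ (A x) x = 0) → A ≠ 0 →
          (∀ t < 0, ∀ x, fderiv ℝ (u t) x (x + A x) + u t x + (2 * t) • timeDeriv u t x - A (u t x) = 0) →
          (∀ ε > 0, ∃ R : ℝ, ∀ t < 0, ∀ x, R * Real.sqrt (-t) ≤ ‖x‖ → Real.sqrt (-t) * ‖u t x‖ ≤ ε) →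
          ∀ t < 0, ∀ x, u t x = 0) ↔
      ∀ (C : ℝ) (u : ℝ → E3 → E3), IsTypeIAncientMild C u →
        ∀ A : E3 →L[ℝ] E3, (∀ x, inner ℝ (A x) x = 0) → A ≠ 0 →
          (∀ t < 0, ∀ x, fderiv ℝ (u t) x (x + A x) + u t x + (2 * t) • timeDeriv u t x - A (u t x) = 0) →
          (∃ K : ℝ, HasTypeIDecay K u) → ∀ t < 0, ∀ x, u t x = 0 := by
  constructor
  · intro h C u hu A hA hA0 hL _
    exact h C u hu A hA hA0 hL (rssFarFieldVanishing C u hu A hA hL)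
  · intro h C u hu A hA hA0 hL _
    exact h C u hu A hA hA0 hL (rssFarFieldTypeIDecay C u hu A hA hL)

/-- **The crux `SymmetricLiouville` (stmt-NavierStokesRegularity-4053) BY NAME from the canonical conjecture leaf
`TypeIDSSLiouvilleConjecture`** (Bradshaw–Tsai OP 5.1 / Tsai GSM 192 Conj. 8.8–8.9, rotated half): the landed bridge
T7 `stub_rssCoreOfConjecture` gives RSS Liouville in Pineau–Vicol's class inside `A_C`, B2 (`core_iff_coreTypeI`)
removes the class hypothesis, and `symmetricLiouville_iff_core` concludes. CONDITIONAL on the conjecture (the item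
stays open on it). [cite: BradshawTsai2017CPDE, §5 Open Problem 5.1] -/
theorem symmetricLiouville_of_typeIDSSLiouvilleConjecture
    (hConj : _root_.Summit.NavierStokesRegularity.NavierStokesRegularity.TypeIDSSLiouvilleConjecture) :
    SymmetricLiouville :=
  symmetricLiouville_iff_core.2 (core_iff_coreTypeI.2 (stub_rssCoreOfConjecture hConj))

end Summit.NavierStokesRegularity.NavierStokesRegularity.Theorems.SymmetryModuliCountSymmetricLiouville

end
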